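import Literature.NumberTheory.Automorphic.Liu2021.LemD1AsPrintedIndexedNonVacuityCharacterDecisionAllRanksAbelianizationSplit
import Literature.LinearAlgebra.Matrix.GeneralLinearGroupAbelianization
import HarnessLib

/-!
# [Liu2021, App. D Lemma D.1 (3)] bookkeeping — SPLIT places, `U(V)(F_v) ≅ GL_N(E_w)`: every (continuous) character of `U(V)(F_v)` is a
# UNIQUE (continuous) character of `E_wˣ` composed with `g ↦ det(g_w)`

Reproduction ∕ bookkeeping (Literature, THEOREMS ONLY: no definition, no record, no named fact, no `sorry`; nothing is
asserted about Liu's oscillator representations or about the tree's constructed local Weil carriers).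

Sequel of ✔ `…AbelianizationSplit` (`commutator S.U = ker det` at split places) and ✔ `…AbelianizationContinuous` (continuous section of `det` at
NON-split places).  At a SPLIT place `w ∣ v` (`c • w ≠ w`) the place model `S.U = U(V)(F_v)` of [Liu2021, App. D §D.1] is `GL_N(E_w)` through the
projection `g ↦ g_w` (✔ `UnitaryGroupSplitPlace.localSplitEquiv`, an isomorphism of topological groups, [Mok2014, §1]), and the abelianization of
`GL_N(E_w)` is `E_wˣ` via `det` (✔ `LinearAlgebra/Matrix/GeneralLinearGroupAbelianization`, [Dieudonne1971GroupesClassiques, Chap. II §1]).  Hence,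
for EVERY `N ≥ 2`, EVERY hermitian non-degenerate `J` and EVERY quadratic `E/F`:

* §1 **`existsUnique_factor_detAt_of_split`** — every homomorphism `Ψ : S.U →* A` to a commutative group is `ψ(det g_w)` for a UNIQUE
  `ψ : E_wˣ →* A` (`g_w = GeneralLinearGroup.map (eval_w) g`, the `w`-component of `g ∈ GL_N(Π_{w'} E_{w'})`).
* §2 **`continuous_iff_of_factor_detAt_of_split`** — `Ψ` is continuous iff `ψ` is (the section `u ↦ diag(u, 1, …, 1)` of `det` on `GL_N(E_w)` is
  continuous, ✔ `DiagonalTorus.continuous_diagGL`; `g ↦ g_w` is a homeomorphism); hence **`existsUnique_continuous_factor_detAt_of_split`**: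
  «continuous characters of `U(V)(F_v)` at a split place» = «continuous characters of `E_wˣ`» through `det(·_w)`.

With ✔ `…AbelianizationContinuous` (non-split places, through `E_v¹`) the continuous one-dimensional bookkeeping of [Lem. D.1 (3)] is settled at
EVERY finite place.  HC_CM is NOT proved.

Cell pub-hodgecm2 (COR-CM), audit class of the END rows `hD1''` ∕ `hD3`; seat prover-pub-hodgecm2-b10.

References: [Liu2021] Y. Liu, *Fourier–Jacobi cycles and arithmetic relative trace formula*, Camb. J. Math. 9 (2021) =
arXiv:2102.11518, App. D §D.1 (l. 5213–5221), Lemma D.1 (3) (l. 5233); [Mok2014] C. P. Mok, Mem. AMS 235 (2015), §1 Notation p. 5;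
[Dieudonne1971GroupesClassiques] J. Dieudonné, *La géométrie des groupes classiques*, 3e éd. (1971), Chap. II §1; [Artin1988] E. Artin,
*Geometric Algebra* (1957), Chap. IV Thm. 4.6.
-/

noncomputable section

open scoped Matrix MatrixGroups
open NumberField IsDedekindDomain
open Literature.RepresentationTheory
open Literature.RepresentationTheory.Liu2021 (OscillatorStandingData)
open Literature.NumberTheory.GaloisRepresentations (HeckeCharacter)

namespace Literature.NumberTheory.Automorphic.Liu2021.LemD1IndexedNonVacuityCharacterDecisionAllRanksAbelianizationSplitContinuous

open UnitaryGroup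
open Literature.LinearAlgebra.Matrix (GLAbelianization.existsUnique_eq_comp_det)

section Split

variable {F : Type} (E : Type) [Field F] [NumberField F] [Field E] [NumberField E] [Algebra F E]
  [Algebra.IsQuadraticExtension F E] (v : HeightOneSpectrum (𝓞 F)) (c : E ≃ₐ[F] E)
  {δ : E} (hcδ : c δ = -δ) (hδ : δ ≠ 0)
  (N : ℕ) (J : Matrix (Fin N) (Fin N) E) (hN : 2 ≤ N) (hJh : (J.map c)ᵀ = J) (hJdet : J.det ≠ 0)

omit [NumberField F] [Algebra.IsQuadraticExtension F E] in
include hcδ hδ in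
/-- `c ≠ 1` (`c δ = −δ ≠ δ`); copy of the siblings' private lemma. [folklore] -/
private theorem hc_of_delta : c ≠ 1 := by
  rintro rfl
  rw [AlgEquiv.one_apply] at hcδ
  have h2 : (2 : E) * δ = 0 := by linear_combination hcδ
  exact hδ ((mul_eq_zero.mp h2).resolve_left two_ne_zero)

include hcδ hδ hN hJh hJdet in
/-- **The `w`-projection `S.U ≃* GL_N(E_w)` at a SPLIT place as an isomorphism of topological groups with `e g = g_w`**: packaging
`S.U = «local»` (✔ `LemD1OfPlace.mem_U_iff`) with ✔ `localSplitEquiv`. [cite: Mok2014, §1 Notation p. 5] -/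
private theorem exists_mulEquiv_of_split (w : PlacesOver E v) (hw : c • w.1 ≠ w.1) :
    ∃ e : (LemD1OfPlace.standingData E v c N J hcδ hδ hN hJh hJdet).U ≃* GL (Fin N) (w.1.adicCompletion E),
      Continuous e ∧ Continuous e.symm ∧
      ∀ g, e g = Matrix.GeneralLinearGroup.map (Pi.evalRingHom (fun w' : PlacesOver E v => w'.1.adicCompletion E) w)
        (g : GL (Fin N) (LocalRing E v)) := by
  have hc : c ≠ 1 := hc_of_delta E c hcδ hδ
  have hJu : IsUnit J := (Matrix.isUnit_iff_isUnit_det J).2 (IsUnit.mk0 _ hJdet)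
  have hJw : IsUnit (placeForm J w.1) := isUnit_placeForm J hJu w.1
  have hEq : (LemD1OfPlace.standingData E v c N J hcδ hδ hN hJh hJdet).U = «local» E c N J v :=
    Subgroup.ext fun x => LemD1OfPlace.mem_U_iff E v c N J hcδ hδ hN hJh hJdet x
  let e₀ := localSplitEquiv c J hc hJh w hw hJw
  refine ⟨(MulEquiv.subgroupCongr hEq).trans e₀.toMulEquiv, ?_, ?_, fun g => Units.ext rfl⟩
  · change Continuous fun g => e₀ (MulEquiv.subgroupCongr hEq g)
    exact e₀.continuous.comp (continuous_subtype_val.subtype_mk _)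
  · change Continuous fun h => (MulEquiv.subgroupCongr hEq).symm (e₀.symm h)
    exact (continuous_subtype_val.subtype_mk _).comp e₀.symm.continuous

include hcδ hδ hN hJh hJdet in
/-- **At a SPLIT place every homomorphism `U(V)(F_v) →* A` to a commutative group is a UNIQUE character of `E_wˣ` composed with `g ↦ det g_w`**
(every `N ≥ 2`, every hermitian non-degenerate `J`, every quadratic `E/F`; `E_w ⊇ E` is not `𝔽₂`): through `S.U ≅ GL_N(E_w)` and
✔ `GLAbelianization.existsUnique_eq_comp_det`. [cite: Dieudonne1971GroupesClassiques, Chap. II §1] [cite: Mok2014, §1 Notation p. 5]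
[cite: Liu2021, App. D §D.1 Step 3 (l. 5221) and Lemma D.1 (3) (l. 5233)] -/
theorem existsUnique_factor_detAt_of_split {A : Type*} [CommGroup A] (w : PlacesOver E v) (hw : c • w.1 ≠ w.1)
    (Ψ : (LemD1OfPlace.standingData E v c N J hcδ hδ hN hJh hJdet).U →* A) :
    ∃! ψ : (w.1.adicCompletion E)ˣ →* A, ∀ g : (LemD1OfPlace.standingData E v c N J hcδ hδ hN hJh hJdet).U,
      Ψ g = ψ (Matrix.GeneralLinearGroup.det (Matrix.GeneralLinearGroup.map
        (Pi.evalRingHom (fun w' : PlacesOver E v => w'.1.adicCompletion E) w) (g : GL (Fin N) (LocalRing E v)))) := by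
  haveI : Nonempty (Fin N) := ⟨⟨0, by omega⟩⟩
  have hF : ∃ a : w.1.adicCompletion E, a ≠ 0 ∧ a ≠ 1 := by
    refine ⟨2, ?_, fun h => one_ne_zero (α := w.1.adicCompletion E) (by linear_combination h)⟩
    rw [← map_ofNat (algebraMap E (w.1.adicCompletion E)) 2]
    exact (_root_.map_ne_zero _).2 two_ne_zero
  obtain ⟨e, -, -, he⟩ := exists_mulEquiv_of_split E v c hcδ hδ N J hN hJh hJdet w hw
  obtain ⟨ψ, hψ, huniq⟩ := GLAbelianization.existsUnique_eq_comp_det hF (Ψ.comp e.symm.toMonoidHom)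
  refine ⟨ψ, fun g => ?_, fun ψ' hψ' => huniq ψ' ?_⟩
  · have h := congrArg (fun φ : GL (Fin N) (w.1.adicCompletion E) →* A => φ (e g)) hψ
    simp only [MonoidHom.comp_apply, MulEquiv.coe_toMonoidHom, MulEquiv.symm_apply_apply] at h
    rw [h, he]
  · ext h
    rw [MonoidHom.comp_apply, MulEquiv.coe_toMonoidHom, MonoidHom.comp_apply, hψ' (e.symm h), ← he (e.symm h),
      MulEquiv.apply_symm_apply]

include hcδ hδ hN hJh hJdet in
/-- **Continuity transfer at a SPLIT place: `Ψ` is continuous iff its factor `ψ` through `det(·_w)` is** (`g ↦ g_w` is a homeomorphism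
`S.U ≃ GL_N(E_w)`; `u ↦ diag(u, 1, …, 1)` is a continuous section of `det`, ✔ `DiagonalTorus.continuous_diagGL`). [cite: Mok2014, §1 Notation p. 5]
[cite: Dieudonne1971GroupesClassiques, Chap. II §1] -/
theorem continuous_iff_of_factor_detAt_of_split {A : Type*} [CommGroup A] [TopologicalSpace A] (w : PlacesOver E v)
    (hw : c • w.1 ≠ w.1) (Ψ : (LemD1OfPlace.standingData E v c N J hcδ hδ hN hJh hJdet).U →* A) (ψ : (w.1.adicCompletion E)ˣ →* A)
    (hfac : ∀ g : (LemD1OfPlace.standingData E v c N J hcδ hδ hN hJh hJdet).U,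
      Ψ g = ψ (Matrix.GeneralLinearGroup.det (Matrix.GeneralLinearGroup.map
        (Pi.evalRingHom (fun w' : PlacesOver E v => w'.1.adicCompletion E) w) (g : GL (Fin N) (LocalRing E v))))) :
    Continuous Ψ ↔ Continuous ψ := by
  classical
  haveI : Nonempty (Fin N) := ⟨⟨0, by omega⟩⟩
  obtain ⟨e, hecont, hesymm, he⟩ := exists_mulEquiv_of_split E v c hcδ hδ N J hN hJh hJdet w hw
  constructor
  · intro hΨ
    -- `ψ u = Ψ (e.symm (diag(u, 1, …, 1)))`
    let i₀ : Fin N := ⟨0, by omega⟩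
    have hdet : ∀ u : (w.1.adicCompletion E)ˣ,
        Matrix.GeneralLinearGroup.det (Literature.LinearAlgebra.Matrix.DiagonalTorus.diagGL (Fin N) (Pi.mulSingle i₀ u)) = u := by
      intro u
      apply Units.ext
      rw [Matrix.GeneralLinearGroup.val_det_apply, Literature.LinearAlgebra.Matrix.DiagonalTorus.val_diagGL, Matrix.det_diagonal,
        ← Units.coe_prod, Finset.prod_pi_mulSingle' i₀ u Finset.univ, if_pos (Finset.mem_univ _)]
    have heq : ⇑ψ = fun u => Ψ (e.symm (Literature.LinearAlgebra.Matrix.DiagonalTorus.diagGL (Fin N) (Pi.mulSingle i₀ u))) := by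
      funext u
      rw [hfac, ← he, MulEquiv.apply_symm_apply, hdet]
    rw [heq]
    have hms : Continuous fun u : (w.1.adicCompletion E)ˣ => (Pi.mulSingle i₀ u : Fin N → (w.1.adicCompletion E)ˣ) :=
      continuous_mulSingle (A := fun _ : Fin N => (w.1.adicCompletion E)ˣ) i₀
    exact hΨ.comp (hesymm.comp (Literature.LinearAlgebra.Matrix.DiagonalTorus.continuous_diagGL.comp hms))
  · intro hψ
    have heq : ⇑Ψ = fun g : (LemD1OfPlace.standingData E v c N J hcδ hδ hN hJh hJdet).U =>
        ψ (Matrix.GeneralLinearGroup.det (Matrix.GeneralLinearGroup.map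
          (Pi.evalRingHom (fun w' : PlacesOver E v => w'.1.adicCompletion E) w) (g : GL (Fin N) (LocalRing E v)))) := funext hfac
    rw [heq]
    exact hψ.comp (Matrix.GeneralLinearGroup.continuous_det.comp
      (((continuous_apply w).generalLinearGroup_map).comp continuous_subtype_val))

include hcδ hδ hN hJh hJdet in
/-- **«Continuous characters of `U(V)(F_v)` at a SPLIT place» = «continuous characters of `E_wˣ`» through `det(·_w)`**: for every CONTINUOUS
`Ψ : S.U →* A` there is a UNIQUE `ψ : E_wˣ →* A` with `Ψ g = ψ (det g_w)`, and it is CONTINUOUS (every `N ≥ 2`, every hermitian `J`, every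
quadratic `E/F`). [cite: Dieudonne1971GroupesClassiques, Chap. II §1] [cite: Mok2014, §1 Notation p. 5]
[cite: Liu2021, App. D §D.1 Step 3 (l. 5221) and Lemma D.1 (3) (l. 5233)] -/
theorem existsUnique_continuous_factor_detAt_of_split {A : Type*} [CommGroup A] [TopologicalSpace A] (w : PlacesOver E v)
    (hw : c • w.1 ≠ w.1) (Ψ : (LemD1OfPlace.standingData E v c N J hcδ hδ hN hJh hJdet).U →* A) (hΨ : Continuous Ψ) :
    ∃! ψ : (w.1.adicCompletion E)ˣ →* A, Continuous ψ ∧ ∀ g : (LemD1OfPlace.standingData E v c N J hcδ hδ hN hJh hJdet).U,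
      Ψ g = ψ (Matrix.GeneralLinearGroup.det (Matrix.GeneralLinearGroup.map
        (Pi.evalRingHom (fun w' : PlacesOver E v => w'.1.adicCompletion E) w) (g : GL (Fin N) (LocalRing E v)))) := by
  obtain ⟨ψ, hψ, huniq⟩ := existsUnique_factor_detAt_of_split E v c hcδ hδ N J hN hJh hJdet w hw Ψ
  exact ⟨ψ, ⟨(continuous_iff_of_factor_detAt_of_split E v c hcδ hδ N J hN hJh hJdet w hw Ψ ψ hψ).1 hΨ, hψ⟩,
    fun ψ' hψ' => huniq ψ' hψ'.2⟩

end Split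

end Literature.NumberTheory.Automorphic.Liu2021.LemD1IndexedNonVacuityCharacterDecisionAllRanksAbelianizationSplitContinuous
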